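import Literature.NumberTheory.Automorphic.AutomorphicKernel
import Literature.NumberTheory.Sieve.QuadraticRootsPrimeModuliDFIGamma0Domain
import Literature.NumberTheory.Sieve.GrimmeltMerikoski2025KernelDiagonal
import HarnessLib

/-!
# Grimmelt–Merikoski 2025, Theorem 2.1 (= [GMtechnical, Thm 8.1]) as a hypothesis schema

L. Grimmelt, J. Merikoski, *On the greatest prime factor and uniform equidistribution of quadratic
polynomials*, arXiv:2505.00493 [GrimmeltMerikoski2025], §2: the technical Theorem 2.1, "Theorem 8.1
in [GMtechnical]" (L. Grimmelt, J. Merikoski, *Weighted averages of `SL₂(ℝ)` automorphic kernel,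
Part I: non-oscillatory functions*, arXiv:2505.00489 [GrimmeltMerikoski2025Kernel], §8 "A variant
for right `K`-invariant functions", Theorem 8.1 — read and compared: it is Theorem 2.1 verbatim for
a congruence subgroup `Γ` of level `q` with a character `χ`, `f ∈ C¹⁰_δ(𝐗, 𝐘)`, the same condition
`Z₀Z₁Z₂ ≥ 𝐗/𝐘 + 1`, and `θ = θ(Γ)`), is the only non-elementary input of the proof of the
Type I estimate Theorem 1.4 (§5); it rests on the spectral theory of `Γ₀(q)∖SL₂(ℝ)` (with the
exponent `θ = θ(Γ₀(q)) ≤ 7/64` towards Selberg's eigenvalue conjecture, Kim–Sarnak) and is not in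
Mathlib or the tree.  Following the pattern of the tree's Iwaniec layers
(`Literature.NumberTheory.Automorphic.SpectralDatum`, `PretraceEstimate.lean`: "HYPOTHESIS SCHEMA …
data, not a named fact"), this file records **the part of Theorem 2.1 that §5 consumes** as a
`structure GM2025.TechnicalDatum θ` (data + a proof field), so that the remaining, elementary,
layers of §§3–5 can be PROVED against it (`grimmeltMerikoski2025_thm14_restricted_of_technicalDatum`,
assembly layer).  Nothing is asserted here: the structure is a hypothesis to be supplied, and no
named fact is introduced.

## The objects of §2 in the tree's language (`ℍ`, Mathlib's `GL (Fin 2) ℝ`-action and invariant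
`volume = dx dy / y²`, `Literature.NumberTheory.Automorphic.pointPairInv` / `automorphicKernel`,
`Literature.NumberTheory.Sieve.DFI1995.Gamma0GL`)

The paper works on `G = SL₂(ℝ)` with functions `F(g) = f(x/𝐗, y/𝐘)` of the Iwasawa coordinates
`x + iy = g·i` of `g`, i.e. `F(g) = φ(g·i)` with `φ(z) = f(Re z/𝐗, Im z/𝐘)`; with the automorphic
kernel `(𝒦_q F)(τ₁, τ₂) = ∑_{γ ∈ Γ₀(q)} F(τ₁⁻¹γτ₂)` ((2.1)), the local discrepancy
`Δ_q F = 𝒦_q F − |Γ₀(q)∖G|⁻¹ ∫_G F`, compactly supported functionals `⟨f⟩_α = ∑_i a_i f(g_i)`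
(Definition 1, "we are interested only in functionals given by weighted sums"), the pairing
`⟨α₁|F|α₂⟩ = ∑_{i,j} ā_i b_j F(g_i, h_j)` (Definition 2), the point mass `I` at the identity, and
the kernels `k_{Y,R} : G → [0,1]`, `k_{Y,R}(g) ≤ 𝟙{u_R(g) ≤ Y}/√(1 + u_R(g))`,
`u_R(g) = ¼(a² + (b/R)² + (cR)² + d² − 2)`.  For `α₁ = I` and `α₂ = ∑_j b_j δ_{h_j}` with
`b_j ≥ 0` (the only case used in §5: `α₂ = α_{d,a,h}` of (5.2) has the non-negative weights
`|Γ_{σi}|⁻¹ 𝟙[…]`) everything depends on the points `w_j = h_j·i ∈ ℍ` only: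

* `⟨I|𝒦_q F|α₂⟩ = ∑_j b_j ∑_{γ ∈ Γ₀(q)} φ(γ·w_j)` — `GM2025.orbitSum`;
* the main term `|Γ₀(q)∖G|⁻¹ ∫_G F dg ⟨1⟩_I ⟨1⟩_{α₂} = m_q (∫_ℍ φ dμ) ∑_j b_j` with
  `m_q = vol(Γ₀(q)∖ℍ)⁻¹` (the `K`-volumes cancel);
* `⟨α₂|𝒦_q k_{Z,1}|α₂⟩ = ∑_{i,j} b_i b_j ∑_{γ ∈ Γ₀(q)} k(u(γ·w_j, w_i))`
  (`u_1(h_i⁻¹γh_j) = u(γ h_j i, h_i i)`), i.e. `∑ b_i b_j · automorphicKernel Γ₀(q) k w_j w_i`;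
* `⟨I|𝒦_q k_{Z,R}|I⟩ = ∑_{γ ∈ Γ₀(q)} k(u_R(γ))` and `u_R(γ) = u(γ·iR, iR)`, i.e.
  `automorphicKernel Γ₀(q) k (iR) (iR)` (cf. `GM2025.kernelDiagSum`, `KernelDiagonal.lean`).

## What the schema asserts, and why Theorem 2.1 implies it

`GM2025.TechnicalDatum θ` carries constants `m_q > 0` and, for every `ε > 0`, constants `J, C, A`
such that for all `q ≥ 1`, `𝐗, 𝐘 > 0`, `0 < δ ≤ 1` with `δ < 𝐗/𝐘`, all smooth `Ψ₁` supported on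
`[1, 2]` and `Ψ₂` supported on `[-1, 1]` with `|Ψᵢ^{(j)}| ≤ δ^{-j}` (`j ≤ J`), all finite families
of points `w ∈ ℍ` with weights `b_w ≥ 0`, and all `Z₀, Z₁, Z₂ ≥ 1` with `Z₀Z₁Z₂ ≥ 2𝐗/𝐘 + 1`,

  `|∑_w b_w (∑_{γ ∈ Γ₀(q)} φ(γ·w) − m_q ∫_ℍ φ dμ)|`
  `  ≤ C q^ε δ^{-A} (𝐗/𝐘)^{1/2} (1 + 𝐗/𝐘)^ε Z₀^θ (∑_{γ ∈ Γ₀(q)} k⁺_{Z₁²}(u(γ·i𝐗, i𝐗)))^{1/2}`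
  `    × (∑_{w,w'} b_w b_{w'} ∑_{γ ∈ Γ₀(q)} k⁺_{Z₂²}(u(γ·w', w)))^{1/2}`,

where `φ(z) = Ψ₁(𝐘/Im z) Ψ₂(Re z 𝐘/(Im z 𝐗))` (`GM2025.skewTestFun`; in the Lean code the scales `𝐗, 𝐘` are written `sX, sY`) and
`k⁺_Z(u) = 𝟙{u ≤ Z}/√(1+u)` (`GM2025.kPlus`).  This is Theorem 2.1 with `H = 1`, `β(1) = 1`
(so the Hecke operator `𝒯_{1,1}` is the identity), `α₁ = I`, `α₂` a non-negative combination of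
point masses, applied to `f(x', y') = Ψ₁(2/y') Ψ₂(2x'/y')` — smooth, supported on
`[-1,1] × [1,2]`, with `∂_x^{j₁}∂_y^{j₂} f ≪_{j₁,j₂} δ^{-j₁-j₂}` by the one-variable bounds — at the
scales `(𝐗, 𝐘/2)` (for which `f(x/𝐗, 2y/𝐘) = φ(x + iy)`; the theorem's `𝐗/𝐘` becomes `2𝐗/𝐘`,
whence the `2` in the condition on `Z₀Z₁Z₂` and a factor `2^{1/2+o(1)}` absorbed in `C`), and
WEAKENED in three ways: (i) `q^{o(1)} δ^{-O(1)} (𝐗/𝐘)^{1/2+o(1)}` is rendered as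
`C_ε q^ε δ^{-A_ε} (𝐗/𝐘)^{1/2} (1 + 𝐗/𝐘)^ε` (for `𝐗/𝐘 < 1` the factor `(𝐗/𝐘)^{-o(1)} ≤ δ^{-o(1)}`
goes into `δ^{-A}`); (ii) `θ(Γ₀(q))` is replaced by the parameter `θ` (valid as soon as
`θ(Γ₀(q)) ≤ θ` for all `q`, since `Z₀ ≥ 1`; `θ = 7/64` by Kim–Sarnak [KimSarnak], as quoted in the
paper); (iii) on the right-hand side the discrepancies `⟨α|Δ_q k_{Z²,R}|α⟩` are replaced by the
larger `⟨α|𝒦_q k⁺|α⟩` (`k_{Z²,R} ≥ 0` has a non-negative main term, the weights are `≥ 0` and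
`k ≤ k⁺` pointwise) — exactly the form in which §5 uses the theorem ("where by positivity
`K₁ ≤ ∑_q ⟨I|𝒦_q k|I⟩`, `K₂ ≤ ∑_q ⟨α_q|𝒦_q k|α_q⟩`").  Consequently a proof of
[GMtechnical, Thm 8.1] together with `θ(Γ₀(q)) ≤ 7/64` yields an inhabitant of
`GM2025.TechnicalDatum (7/64)`; conversely nothing weaker than that is claimed anywhere in the tree.

## References

* [GrimmeltMerikoski2025] arXiv:2505.00493, §2: (2.1) (`𝒦_q`), `Δ_q`, Definitions 1–2, `u_R`,
  `θ(Γ)`, Theorem 2.1; §5 (the use with `α₁ = I`, `α₂ = α_{d,a,h}`, positivity).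
* [GrimmeltMerikoski2025Kernel] (= [GMtechnical] of the paper) L. Grimmelt, J. Merikoski, *Weighted
  averages of SL₂(ℝ) automorphic kernel, Part I: non-oscillatory functions*, arXiv:2505.00489 (2025),
  §8 Theorem 8.1 (the right-`K`-invariant variant of its Theorem 7.1; proof: spectral expansion of
  automorphic kernels on `Γ∖SL₂(ℝ)` §3, estimates for harmonics §4, decay in spectrum §5, spectral
  majorant §6, main theorem §7) — the missing input for `grimmeltMerikoski2025_thm14_restricted_holds`.
* [KimSarnak] H. Kim, P. Sarnak, J. Amer. Math. Soc. 16 (2003), Appendix 2 (`θ ≤ 7/64`) — as cited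
  in [GrimmeltMerikoski2025, §1.1].
-/

noncomputable section

namespace Literature.NumberTheory.Sieve

open UpperHalfPlane MeasureTheory
open Literature.NumberTheory.Automorphic (pointPairInv automorphicKernel)
open Literature.NumberTheory.Sieve.DFI1995 (Gamma0GL)
open scoped MatrixGroups ContDiff

namespace GM2025

/-- **The orbit sum** `∑_{γ ∈ Γ} φ(γ·w)` of a function `φ` on `ℍ` over a subgroup
`Γ ≤ GL₂(ℝ)` at a point `w` — for `Γ = Γ₀(q)` and `φ(z) = F(g)` (`z = g·i`) this is the value
`(𝒦_q F)(1, h) = ∑_{γ ∈ Γ₀(q)} F(γh)` of the automorphic kernel (2.1) of [GrimmeltMerikoski2025]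
at `τ₁ = 1`, `τ₂ = h`, `w = h·i`, so that `⟨I|𝒦_q F|α⟩ = ∑_j b_j · orbitSum Γ₀(q) φ w_j` for
`α = ∑_j b_j δ_{h_j}`.  Defined as a `finsum` (junk value `0` if infinitely many terms are non-zero;
for `φ` of compact support and discrete `Γ` the sum is finite).
[cite: GrimmeltMerikoski2025, §2 (2.1) and Definition 2] -/
def orbitSum (Γ : Subgroup (GL (Fin 2) ℝ)) (φ : ℍ → ℂ) (w : ℍ) : ℂ :=
  ∑ᶠ γ ∈ (Γ : Set (GL (Fin 2) ℝ)), φ (γ • w)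

/-- **The test functions of Theorem 2.1** in the coordinates `(𝔠, 𝔟) = (1/y, x/y)`:
`φ(z) = Ψ₁(sY / Im z) · Ψ₂(Re z · sY / (Im z · sX))`, i.e. `φ(x + iy) = f(x/sX, y/(sY/2))` for
`f(x', y') = Ψ₁(2/y') Ψ₂(2x'/y')`; for `Ψ₁` supported on `[1,2]` and `Ψ₂` on `[-1,1]` it is
supported on `Im z ∈ [sY/2, sY]`, `|Re z| ≤ sX Im z/sY ≤ sX`.  In §5 of the paper
`F_j = φ` with `Ψ₁ = ψ₁`, `Ψ₂ = ψ₂(−·)`, `sY = √(h/a)/K`, `sX = X_j/K`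
(`F_{⋄,j}(𝔤) = ψ₁(𝔠√(ah)/(aK)) ψ₂(𝔟√(ah)/(aX_j))`, `𝔠 = 1/y`, `𝔟 = x/y`).
[cite: GrimmeltMerikoski2025, Theorem 2.1 (F(g) = f(x/sX, y/sY)) and §5 (F_{⋄,j})] -/
def skewTestFun (Ψ₁ Ψ₂ : ℝ → ℂ) (sX sY : ℝ) (z : ℍ) : ℂ :=
  Ψ₁ (sY / z.im) * Ψ₂ (z.re * sY / (z.im * sX))

/-- The point `iR ∈ ℍ` (`R > 0`), base point of the `R`-skewed size: `u_R(γ) = u(γ·iR, iR)`.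
[cite: GrimmeltMerikoski2025, §2 (u_R)] -/
def iPt (R : ℝ) (hR : 0 < R) : ℍ :=
  UpperHalfPlane.mk ((R : ℂ) * Complex.I) (by simpa using hR)

/-- `Im (iR) = R`. [folklore] -/
@[simp] theorem iPt_im (R : ℝ) (hR : 0 < R) : (iPt R hR).im = R := by
  simp [iPt, UpperHalfPlane.mk_im]

/-- `Re (iR) = 0`. [folklore] -/
@[simp] theorem iPt_re (R : ℝ) (hR : 0 < R) : (iPt R hR).re = 0 := by
  simp [iPt, UpperHalfPlane.mk_re]

/-- One-variable smooth weight supported on `[lo, hi]` with `|Ψ^{(j)}| ≤ δ^{-j}` for `j ≤ J` —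
the hypothesis "`∂_x^{J₁}∂_y^{J₂} f ≪_{J₁,J₂} δ^{-J₁-J₂}`" of Theorem 2.1 for the factors of
`f(x', y') = Ψ₁(2/y')Ψ₂(2x'/y')`. [cite: GrimmeltMerikoski2025, Theorem 2.1 (hypotheses on f)] -/
def IsDeltaWeight (Ψ : ℝ → ℂ) (lo hi : ℝ) (J : ℕ) (δ : ℝ) : Prop :=
  ContDiff ℝ ∞ Ψ ∧ (∀ t : ℝ, Ψ t ≠ 0 → lo ≤ t ∧ t ≤ hi) ∧
    ∀ j : ℕ, j ≤ J → ∀ t : ℝ, ‖iteratedDeriv j Ψ t‖ ≤ δ ^ (-(j : ℝ))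

/-- **Theorem 2.1 of [GrimmeltMerikoski2025] (= [GrimmeltMerikoski2025Kernel, Thm 8.1]) with exponent `θ`, in
the form consumed by §5, as a HYPOTHESIS SCHEMA** (data, not a named fact; see the module
docstring for the dictionary with the paper's `⟨I|Δ_q F|α⟩`, `⟨I|𝒦_q k_{Z₁²,sX}|I⟩`,
`⟨α|𝒦_q k_{Z₂²,1}|α⟩` and for why the printed theorem — with `θ(Γ₀(q)) ≤ θ` — yields an
inhabitant).  Fields: the main-term constants `m q` (`= vol(Γ₀(q)∖ℍ)⁻¹` in the theorem) and the
bound: for every `ε > 0` there are `J`, `C`, `A` such that for `q ≥ 1`, `sX, sY > 0`,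
`0 < δ ≤ 1`, `δ < sX/sY`, `Ψ₁, Ψ₂` `δ`-weights on `[1,2]`, `[-1,1]` up to order `J`, every finite
set `S ⊆ ℍ` with weights `b ≥ 0`, and `Z₀, Z₁, Z₂ ≥ 1` with `Z₀Z₁Z₂ ≥ 2sX/sY + 1`:
`|∑_{w ∈ S} b_w (orbitSum Γ₀(q) φ w − m_q ∫_ℍ φ)| ≤ C q^ε δ^{-A} (sX/sY)^{1/2} (1+sX/sY)^ε Z₀^θ`
`· (automorphicKernel Γ₀(q) k⁺_{Z₁²} (isX) (isX))^{1/2} (∑_{w,w' ∈ S} b_w b_{w'} automorphicKernel Γ₀(q) k⁺_{Z₂²} w' w)^{1/2}`,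
`φ = skewTestFun Ψ₁ Ψ₂ sX sY`, `k⁺_Z = kPlus Z`.
[cite: GrimmeltMerikoski2025, Theorem 2.1 and §5 (application with α₁ = I, α₂ = α_{d,a,h})] -/
structure TechnicalDatum (θ : ℝ) where
  /-- the main-term constants `m_q` (`= vol(Γ₀(q)∖ℍ)⁻¹`) -/
  m : ℕ → ℝ
  /-- positivity of the main-term constants -/
  m_pos : ∀ q : ℕ, 0 < m q
  /-- the bound of Theorem 2.1 in the form used in §5 -/
  bound : ∀ ε : ℝ, 0 < ε → ∃ J : ℕ, ∃ C A : ℝ, 0 < C ∧ 0 < A ∧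
    ∀ q : ℕ, 1 ≤ q →
    ∀ (sX sY δ : ℝ) (hsX : 0 < sX), 0 < sY → 0 < δ → δ ≤ 1 → δ < sX / sY →
    ∀ Ψ₁ Ψ₂ : ℝ → ℂ, IsDeltaWeight Ψ₁ 1 2 J δ → IsDeltaWeight Ψ₂ (-1) 1 J δ →
    ∀ (S : Finset ℍ) (b : ℍ → ℝ), (∀ w, 0 ≤ b w) →
    ∀ Z₀ Z₁ Z₂ : ℝ, 1 ≤ Z₀ → 1 ≤ Z₁ → 1 ≤ Z₂ → 2 * sX / sY + 1 ≤ Z₀ * Z₁ * Z₂ →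
      ‖∑ w ∈ S, (b w : ℂ) *
          (orbitSum (Gamma0GL q) (skewTestFun Ψ₁ Ψ₂ sX sY) w -
            (m q : ℂ) * ∫ z : ℍ, skewTestFun Ψ₁ Ψ₂ sX sY z)‖ ≤
        C * (q : ℝ) ^ ε * δ ^ (-A) * (sX / sY) ^ (1 / 2 : ℝ) * (1 + sX / sY) ^ ε * Z₀ ^ θ *
          Real.sqrt (automorphicKernel (Gamma0GL q) (kPlus (Z₁ ^ 2)) (iPt sX hsX) (iPt sX hsX)) *
          Real.sqrt (∑ w ∈ S, ∑ w' ∈ S,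
            b w * b w' * automorphicKernel (Gamma0GL q) (kPlus (Z₂ ^ 2)) w' w)

/-! ### Basic API -/

/-- The orbit sum of a finitely supported family is the finite sum. [folklore] -/
theorem orbitSum_eq_sum {Γ : Subgroup (GL (Fin 2) ℝ)} {φ : ℍ → ℂ} {w : ℍ}
    {S : Set (GL (Fin 2) ℝ)} (hS : S.Finite) (hSΓ : S ⊆ Γ)
    (hsupp : ∀ γ ∈ Γ, φ (γ • w) ≠ 0 → γ ∈ S) :
    orbitSum Γ φ w = ∑ γ ∈ hS.toFinset, φ (γ • w) := by
  unfold orbitSum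
  apply finsum_mem_eq_sum_of_inter_support_eq
  ext γ
  simp only [Set.mem_inter_iff, Function.mem_support, SetLike.mem_coe, Set.Finite.coe_toFinset]
  constructor
  · rintro ⟨hγ, hne⟩
    exact ⟨hsupp γ hγ hne, hne⟩
  · rintro ⟨hγ, hne⟩
    exact ⟨hSΓ hγ, hne⟩

/-- The test function vanishes unless `sY/2 ≤ Im z ≤ sY` (for `Ψ₁` supported on `[1, 2]`). [cite: GrimmeltMerikoski2025, §5 (support sY of F_j)] -/
theorem skewTestFun_eq_zero_of_im {Ψ₁ Ψ₂ : ℝ → ℂ} {J : ℕ} {δ sX sY : ℝ}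
    (hΨ₁ : IsDeltaWeight Ψ₁ 1 2 J δ) {z : ℍ}
    (hz : z.im < sY / 2 ∨ sY < z.im) : skewTestFun Ψ₁ Ψ₂ sX sY z = 0 := by
  unfold skewTestFun
  have him := z.im_pos
  suffices h : Ψ₁ (sY / z.im) = 0 by rw [h, zero_mul]
  by_contra h
  obtain ⟨h1, h2⟩ := hΨ₁.2.1 _ h
  rcases hz with hz | hz
  · rw [div_le_iff₀ him] at h2
    linarith
  · rw [le_div_iff₀ him] at h1
    linarith

/-- The test function vanishes unless `|Re z| ≤ sX · Im z / sY` (for `Ψ₂` supported on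
`[-1, 1]`, `sX, sY > 0`). [cite: GrimmeltMerikoski2025, §5 (support sX_j of F_j)] -/
theorem skewTestFun_eq_zero_of_re {Ψ₁ Ψ₂ : ℝ → ℂ} {J : ℕ} {δ sX sY : ℝ}
    (hΨ₂ : IsDeltaWeight Ψ₂ (-1) 1 J δ) (hsX : 0 < sX) (hsY : 0 < sY) {z : ℍ}
    (hz : sX * z.im / sY < |z.re|) : skewTestFun Ψ₁ Ψ₂ sX sY z = 0 := by
  unfold skewTestFun
  have him := z.im_pos
  suffices h : Ψ₂ (z.re * sY / (z.im * sX)) = 0 by rw [h, mul_zero]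
  by_contra h
  obtain ⟨h1, h2⟩ := hΨ₂.2.1 _ h
  have hpos : 0 < z.im * sX := by positivity
  have habs : |z.re * sY / (z.im * sX)| ≤ 1 := abs_le.mpr ⟨h1, h2⟩
  rw [abs_div, abs_of_pos hpos, div_le_one hpos, abs_mul, abs_of_pos hsY] at habs
  rw [div_lt_iff₀ hsY] at hz
  nlinarith

/-- A `δ`-weight is bounded by `1` (order `0`). [folklore] -/
theorem IsDeltaWeight.norm_le {Ψ : ℝ → ℂ} {lo hi : ℝ} {J : ℕ} {δ : ℝ}
    (hΨ : IsDeltaWeight Ψ lo hi J δ) (t : ℝ) : ‖Ψ t‖ ≤ 1 := by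
  have h := hΨ.2.2 0 (Nat.zero_le _) t
  simpa using h

end GM2025

end Literature.NumberTheory.Sieve

end
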